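/-
Copyright (c) 2026 the pub-hodgecm-mathlib formalisation cell (harness21).  Prover seat hodgecm-mathlib-R90-C10-p07 (g3), SLAB R90-TF, section S1 «Ch10-local», U4Keys :182 wild
corner (S-W), brick (W-0b) (dealer R90-C10-plan (g3) 2026-09-05T03:20:50Z): the `htmin`-FREE ∕ OF-RECORD form of ★ (O1) `K2E3ConcaveLevelIwahoriCharacterMin` (K2E3-p34 (g3)), at
MODEL level and dressed on `U(Φ₃)(L⁺_v)`, the minimality letter discharged by ★ (W-0) `R90S1WildTraceOneMinimal` (R90-C10-p01 (g4)).  THEOREMS ONLY.  NOT THE PAYER of :182.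
-/
import Summits.HodgeConjecture.HodgeConjecture.Theorems.K2E3ConcaveLevelIwahoriCharacterMin   -- ★ (O1) p863752 (K2E3-p34 (g3)): `v_mul_norm_le_of_traceMin`, `v_add_mul_le_of_traceMin`, `chi_mk0_one_add_eq_one_of_traceMin`, `chi_mul_apply_zero_zero_of_traceMin`, `chi_apply_zero_zero_mul_of_concave_min`; brings ★ p862449 model blocks
import Summits.HodgeConjecture.HodgeConjecture.Theorems.K2E3ConcaveLevelIwahoriCharacterCM    -- ★ p862709 (K2E3-p34 (g2)): `map_mem_of_mem`, `isUnit_apply_zero_zero_of_mem`, `isUnit_update_of_ne_zero`, `conjLocal_update_fixed`; brings ★ Z2A-3b frame (`coe_eA_apply`, `isUnit_of_apply_ne_zero`)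
import Summits.HodgeConjecture.HodgeConjecture.Theorems.R90S1WildTraceOneMinimal             -- ★ (W-0) (R90-C10-p01 (g4)): `exists_traceOne_min` (model), `exists_traceOne_min_adic` (the place `w`)
import HarnessLib

/-!
# R90 · S1 ∕ U4Keys :182, THE WILD CORNER (S-W) — brick (W-0b): THE TWO-DEPTH IWAHORI CHARACTER WITH A MINIMAL TRACE-ONE ELEMENT, OF RECORD
# «`θ(g) = χ₁(g₀₀)` is multiplicative on `J_e = eA⁻¹(Jg)` under the `|t|`-WEIGHTED concavity inequalities for ANY trace-one `t` — no integrality, no minimality letter»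
# [Tits1979 §1.15; BruhatTits1972 (4.4.4), (6.4.9); Roche1998 §3; MoyPrasad1996 §3; Serre1979 III §3; PlatonovRapinchuk1994 §5.1]

Cell `pub/hodgecm-mathlib` (D-0151), SLAB R90-TF, section S1, crux H413 = `stmt-HodgeConjecture-24833` (lane `--supports … --as helper`), route of record `HCCMUnconditional`;
prover seat `hodgecm-mathlib-R90-C10-p07` (g3); dealer card (W-0b) 03:20:50Z on R90-C10-p02 (g3)'s census `CENSUS-SW-firstbrick.v1.md` f6499a1ef9af7a8e §6.  THEOREMS ONLY.
NOT THE PAYER of :182 — (S-W) infrastructure for the determinant road at a wild place ((R-b), (R-a) with `n ≥ δ`) and for Road I's base case (K2E3 (O2)).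

THE POINT.  ★ (O1) `K2E3ConcaveLevelIwahoriCharacterMin` (MODEL level: valued field `K`, isometric involution `σ`, uniformiser `ϖ`) proves `χ₁((jj′)₀₀) = χ₁(j₀₀)·χ₁(j′₀₀)` on the
concave-level group `Jg` with ★ p862449's INTEGRALITY `|t| ≤ 1` of the trace-one element replaced by MINIMALITY `htmin : ∀ a, a + σa = 1 → |t| ≤ |a|` and the two `t`-sensitive
concavity inequalities carried with their `|t|`-weight.  At a wildly ramified dyadic place no integral trace-one element exists (★ p862457) but a MINIMAL one does — ★ (W-0)
`R90.S1.exists_traceOne_min` (R90-C10-p01 (g4)) when `σ` moves something; and if `σ` moves nothing a trace-one `t` is `2⁻¹`, the ONLY trace-one element, hence minimal.  So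
(§2 `exists_traceMin_of_traceOne`) **a minimal trace-one element exists as soon as ANY trace-one `t` does**, and since `|t₀| ≤ |t|` the weighted inequalities for `t` imply
those for `t₀`: ★ (O1) holds with the binder `htmin` DELETED and nothing else moved (§2).  §3 dresses (O1) on `U(Φ₃)(L⁺_v)` exactly as ★ p862709 `K2E3ConcaveLevelIwahoriCharacterCM`
dresses ★ p862449 (`χ₁ : (L ⊗ L⁺_v)ˣ → ℂˣ`, letters `hcond` ∕ `hcondF`, frame `(L v w hw eA heA ϖ hϖ e Jg hJg Je hJe)`, a MINIMAL trace-one `t ∈ L_w`: the «θ-CM twin»), and §4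
discharges the minimality letter at the place of record by ★ (W-0) `exists_traceOne_min_adic L v w hw` (ANY trace-one `t ∈ L_w`; at a tame place take `t` integral — ★
p862709's plain inequalities; at a wild place with different exponent `d`, `|t| = |ϖ|^{−(d−1)}`: they read `e 0 2 + 2·e 1 0 ≥ n + d − 1`, `e 2 0 + 2·e 0 1 ≥ n + d − 1`).
* §1 (model) `v_beta_mul_zeta_le_of_traceMin` (`|βζ| ≤ |ϖ|^c`, NO `c ≤ n`), **`v_traceMin_correction_le`**, `v_mul_pow_le_of_traceMin` (weights transfer to a minimal `t₀`).
* §2 (model, `htmin`-FREE) `traceMin_of_forall_map_eq`, **`exists_traceMin_of_traceOne`**, and ★ (O1) §2 ∕ §4 with the binder `htmin` deleted: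
  **`chi_mk0_one_add_eq_one_of_traceOne_weighted`**, **`chi_apply_zero_zero_mul_of_concave_weighted`**.
* §3 (CM dress, minimal `t`) **`chi_unit_apply_zero_zero_mul_concave_min`**, `theta_mul_concave_min` — twins of ★ p862709 `chi_unit_apply_zero_zero_mul_concave` ∕ `theta_mul_concave`
  with `hvt ↦ htmin`, `h2, h3 ↦ hT3, hT2` (weighted) and WITHOUT `hcn : c ≤ n`.
* §4 (CM dress, of record) **`chi_unit_apply_zero_zero_mul_concave_ofRecord`**, **`theta_mul_concave_ofRecord`** (the `hθmul` letter of ★ V2b at `B = Je` for ANY trace-one `t ∈ L_w`).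
HONEST LABEL: HC_CM is proved only modulo the 7 printed citations (2 remaining named inputs: hLiu418 = `stmt-HodgeConjecture-24832`, h413 = `stmt-HodgeConjecture-24833`)
until rung 0 closes; count-neutral — this file pays no socket and closes nothing ((S-W) stays the XL residual of :182); no printed citation is discharged; REL ≠ ★ ≠ BUILT.

## References
* [Tits1979] J. Tits, *Reductive groups over local fields*, Proc. Sympos. Pure Math. 33.1 (1979), §1.15 (the ramified quasi-split `SU₃`, the trace constant).
* [BruhatTits1972] F. Bruhat, J. Tits, *Groupes réductifs sur un corps local I*, Publ. Math. IHÉS 41 (1972), (4.4.4), (6.4.9).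
* [Roche1998] A. Roche, *Types and Hecke algebras for principal series representations of split reductive p-adic groups*, Ann. Sci. ÉNS (4) 31 (1998), §3.
* [MoyPrasad1996] A. Moy, G. Prasad, *Jacquet functors and unrefined minimal K-types*, Comment. Math. Helv. 71 (1996), §3.
* [Serre1979] J.-P. Serre, *Local Fields*, GTM 67 (1979), Ch. III §3 Prop. 7 (`Tr(𝔭_E^k) = 𝔭_F^{⌊(k+d)∕e⌋}`).
* [PlatonovRapinchuk1994] V. Platonov, A. Rapinchuk, *Algebraic Groups and Number Theory* (1994), §5.1 (the one-place model at a non-split place).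
-/

set_option autoImplicit false
-- the mandated namespace has the single-problem summit's repeated segment (`HodgeConjecture.HodgeConjecture`)
set_option linter.dupNamespace false

noncomputable section

open NumberField IsDedekindDomain
open scoped Matrix MatrixGroups WithZero Valued
open Literature.NumberTheory Literature.NumberTheory.Automorphic Literature.NumberTheory.Automorphic.UnitaryGroup
open Literature.NumberTheory.Rogawski1990

namespace Summit.HodgeConjecture.HodgeConjecture.R90.S1.WildConcaveLevelMinOfRecord

open Summit.HodgeConjecture.HodgeConjecture.Cruxes.H413
open Summit.HodgeConjecture.HodgeConjecture.Cruxes.H413.K2E3ConcaveLevelIwahoriCharacter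
open Summit.HodgeConjecture.HodgeConjecture.Cruxes.H413.K2E3ConcaveLevelIwahoriCharacterMin
open Summit.HodgeConjecture.HodgeConjecture.Cruxes.H413.K2E3DepthZeroIwahoriCharacterCM

/-! ## §1 Model level: the two valuation bounds with a minimal trace-one element; weights transfer -/

section Model

variable {K : Type*} [Field K] [Valued K ℤᵐ⁰] (σ : K →+* K) {ϖ : K}
  (hσ : ∀ a, σ (σ a) = a) (hvσ : ∀ a, Valued.v (σ a) = Valued.v a) (hvϖ : Valued.v ϖ = WithZero.exp (-1 : ℤ))

include hσ hvϖ in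
/-- **`|βζ| ≤ |ϖ|^c`** for `β := b + t·yσy`, `ζ := z + t·xσx` with `t` MINIMAL among trace-one elements, the row∕column relations `b + σb + yσy = 0`, `z + σz + xσx = 0`,
`|b| ≤ |ϖ|^s`, `|z| ≤ |ϖ|^{s′}` and `c ≤ s + s′` (★ (O1) `v_add_mul_le_of_traceMin`: `|β| ≤ |b|`, `|ζ| ≤ |z|` — no integrality of `t`, no `c ≤ n`).
[cite: Tits1979, §1.15] [cite: BruhatTits1972, (6.4.9)] [cite: Roche1998, §3] -/
theorem v_beta_mul_zeta_le_of_traceMin {t : K} (htmin : ∀ a : K, a + σ a = 1 → Valued.v t ≤ Valued.v a)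
    {y b x z : K} (hb : b + σ b + y * σ y = 0) (hz : z + σ z + x * σ x = 0)
    {c s s' : ℕ} (hvb : Valued.v b ≤ Valued.v ϖ ^ s) (hvz : Valued.v z ≤ Valued.v ϖ ^ s') (h4 : c ≤ s + s') :
    Valued.v ((b + t * (y * σ y)) * (z + t * (x * σ x))) ≤ Valued.v ϖ ^ c :=
  (v_mul_le_pow_add ((v_add_mul_le_of_traceMin σ hσ htmin hb).trans hvb) ((v_add_mul_le_of_traceMin σ hσ htmin hz).trans hvz)).trans
    (v_pow_le_pow_of_le hvϖ h4)

include hσ hvσ hvϖ in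
/-- **The correction term lies in `𝔭ⁿ`, minimal-`t` form**: `|yx − tβ·xσx − tζ·yσy + t²·yσy·xσx| ≤ |ϖ|ⁿ` under `n ≤ r + r′` and the `|t|`-WEIGHTED inequalities
`|t|·|ϖ|^{s+2r′} ≤ |ϖ|ⁿ`, `|t|·|ϖ|^{s′+2r} ≤ |ϖ|ⁿ` — the four bounds inside ★ (O1) `chi_mk0_one_add_eq_one_of_traceMin`, exported. [cite: Tits1979, §1.15] [cite: Roche1998, §3] -/
theorem v_traceMin_correction_le {t : K} (htmin : ∀ a : K, a + σ a = 1 → Valued.v t ≤ Valued.v a)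
    {y b x z : K} (hb : b + σ b + y * σ y = 0) (hz : z + σ z + x * σ x = 0)
    {n r s r' s' : ℕ} (hy : Valued.v y ≤ Valued.v ϖ ^ r) (hvb : Valued.v b ≤ Valued.v ϖ ^ s)
    (hx : Valued.v x ≤ Valued.v ϖ ^ r') (hvz : Valued.v z ≤ Valued.v ϖ ^ s')
    (h1 : n ≤ r + r') (hT2 : Valued.v t * Valued.v ϖ ^ (s + 2 * r') ≤ Valued.v ϖ ^ n)
    (hT3 : Valued.v t * Valued.v ϖ ^ (s' + 2 * r) ≤ Valued.v ϖ ^ n) :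
    Valued.v (y * x - t * (b + t * (y * σ y)) * (x * σ x) - t * (z + t * (x * σ x)) * (y * σ y) + t * t * (y * σ y) * (x * σ x)) ≤
      Valued.v ϖ ^ n := by
  have htN : Valued.v (t * (y * σ y)) ≤ Valued.v b := v_mul_norm_le_of_traceMin σ hσ htmin hb
  have hvβ : Valued.v (b + t * (y * σ y)) ≤ Valued.v ϖ ^ s := (v_add_mul_le_of_traceMin σ hσ htmin hb).trans hvb
  have hvζ : Valued.v (z + t * (x * σ x)) ≤ Valued.v ϖ ^ s' := (v_add_mul_le_of_traceMin σ hσ htmin hz).trans hvz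
  have hxx : Valued.v (x * σ x) ≤ Valued.v ϖ ^ (2 * r') := by rw [two_mul]; exact v_mul_le_pow_add hx (by rwa [hvσ])
  have hyy : Valued.v (y * σ y) ≤ Valued.v ϖ ^ (2 * r) := by rw [two_mul]; exact v_mul_le_pow_add hy (by rwa [hvσ])
  have hE1 : Valued.v (y * x) ≤ Valued.v ϖ ^ n := (v_mul_le_pow_add hy hx).trans (v_pow_le_pow_of_le hvϖ h1)
  have hE2 : Valued.v (t * (b + t * (y * σ y)) * (x * σ x)) ≤ Valued.v ϖ ^ n := by
    rw [map_mul, map_mul]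
    calc Valued.v t * Valued.v (b + t * (y * σ y)) * Valued.v (x * σ x)
          ≤ Valued.v t * Valued.v ϖ ^ s * Valued.v ϖ ^ (2 * r') := mul_le_mul' (mul_le_mul' le_rfl hvβ) hxx
      _ = Valued.v t * Valued.v ϖ ^ (s + 2 * r') := by rw [pow_add, mul_assoc]
      _ ≤ Valued.v ϖ ^ n := hT2
  have hE3 : Valued.v (t * (z + t * (x * σ x)) * (y * σ y)) ≤ Valued.v ϖ ^ n := by
    rw [map_mul, map_mul]
    calc Valued.v t * Valued.v (z + t * (x * σ x)) * Valued.v (y * σ y)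
          ≤ Valued.v t * Valued.v ϖ ^ s' * Valued.v ϖ ^ (2 * r) := mul_le_mul' (mul_le_mul' le_rfl hvζ) hyy
      _ = Valued.v t * Valued.v ϖ ^ (s' + 2 * r) := by rw [pow_add, mul_assoc]
      _ ≤ Valued.v ϖ ^ n := hT3
  have hE4 : Valued.v (t * t * (y * σ y) * (x * σ x)) ≤ Valued.v ϖ ^ n := by
    rw [show t * t * (y * σ y) * (x * σ x) = (t * (y * σ y)) * (t * (x * σ x)) by ring, map_mul Valued.v (t * (y * σ y)) (t * (x * σ x)),
      map_mul Valued.v t (x * σ x)]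
    calc Valued.v (t * (y * σ y)) * (Valued.v t * Valued.v (x * σ x))
          ≤ Valued.v ϖ ^ s * (Valued.v t * Valued.v ϖ ^ (2 * r')) := mul_le_mul' (htN.trans hvb) (mul_le_mul' le_rfl hxx)
      _ = Valued.v t * Valued.v ϖ ^ (s + 2 * r') := by rw [pow_add]; simp only [mul_comm, mul_left_comm]
      _ ≤ Valued.v ϖ ^ n := hT2
  exact Valued.v.map_add_le (Valued.v.map_sub_le (Valued.v.map_sub_le hE1 hE2) hE3) hE4

/-- **Weights transfer to a minimal trace-one element**: if `|t₀| ≤ |a|` for every trace-one `a` and `t` has trace one, then `|t|·|ϖ|ᵏ ≤ g ⟹ |t₀|·|ϖ|ᵏ ≤ g`.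
[cite: Serre1979, Ch. III §3 Prop. 7] [cite: Tits1979, §1.15] -/
theorem v_mul_pow_le_of_traceMin {t₀ t : K} (htmin : ∀ a : K, a + σ a = 1 → Valued.v t₀ ≤ Valued.v a) (ht : t + σ t = 1) {k : ℕ} {g : ℤᵐ⁰}
    (h : Valued.v t * Valued.v ϖ ^ k ≤ g) : Valued.v t₀ * Valued.v ϖ ^ k ≤ g :=
  (mul_le_mul' (htmin t ht) le_rfl).trans h

end Model

/-! ## §2 Model level, `htmin`-FREE: a minimal trace-one element from ANY trace-one element; ★ (O1) §2–§4 with the binder `htmin` deleted -/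

section ModelFree

variable {K : Type*} [Field K] [Valued K ℤᵐ⁰] (σ : K →+* K) {ϖ : K}
  (hσ : ∀ a, σ (σ a) = a) (hvσ : ∀ a, Valued.v (σ a) = Valued.v a) (hvϖ : Valued.v ϖ = WithZero.exp (-1 : ℤ))

/-- **If `σ` moves nothing, a trace-one `t` is minimal** — it is the ONLY trace-one element: `a + a = 1 = t + t` forces `2 ≠ 0` and `a = t`. [cite: Serre1979, Ch. III §3 Prop. 7] -/
theorem traceMin_of_forall_map_eq (hid : ∀ e : K, σ e = e) {t : K} (ht : t + σ t = 1) : ∀ a : K, a + σ a = 1 → Valued.v t ≤ Valued.v a := by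
  intro a ha
  rw [hid] at ht ha
  have h2 : (2 : K) ≠ 0 := fun h => by
    have h1 : (2 : K) * t = 1 := by rw [two_mul]; exact ht
    rw [h, zero_mul] at h1
    exact zero_ne_one h1
  have hat : a = t := mul_left_cancel₀ h2 (by rw [two_mul, two_mul, ha, ht])
  rw [hat]

include hσ hvσ in
/-- **A MINIMAL trace-one element exists as soon as ANY trace-one element does** (★ (W-0) `exists_traceOne_min` when `σ` moves something; `t` itself when `σ` moves
nothing, `traceMin_of_forall_map_eq`) — ★ (W-0)'s `hne : ∃ e, σ e ≠ e` replaced by the trace-one `t` every consumer already holds. [cite: Serre1979, Ch. III §3 Prop. 7] [cite: Tits1979, §1.15] -/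
theorem exists_traceMin_of_traceOne {t : K} (ht : t + σ t = 1) : ∃ t₀ : K, t₀ + σ t₀ = 1 ∧ ∀ a : K, a + σ a = 1 → Valued.v t₀ ≤ Valued.v a := by
  by_cases hne : ∃ e, σ e ≠ e
  · exact exists_traceOne_min σ hσ hvσ hne
  · push Not at hne
    exact ⟨t, ht, traceMin_of_forall_map_eq σ hne ht⟩

include hσ hvσ hvϖ in
/-- **★ (O1) §2 WITH THE MINIMALITY LETTER DELETED — `χ₁(1 + yx + bz) = 1` for ANY trace-one `t` under the `|t|`-weighted inequalities** (★ (O1)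
`chi_mk0_one_add_eq_one_of_traceMin`'s binders minus `htmin`; proof: (O1) at a minimal `t₀` of §2 `exists_traceMin_of_traceOne`, weights transferred by `|t₀| ≤ |t|`).
[cite: Roche1998, §3] [cite: Tits1979, §1.15] [cite: BruhatTits1972, (6.4.9)] [cite: Serre1979, Ch. III §3 Prop. 7] -/
theorem chi_mk0_one_add_eq_one_of_traceOne_weighted (χ₁ : Kˣ →* ℂˣ) {n c : ℕ} (hc1 : 1 ≤ c)
    (hcond : ∀ u : Kˣ, Valued.v ((u : K) - 1) ≤ Valued.v ϖ ^ n → χ₁ u = 1)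
    (hcondF : ∀ u : Kˣ, σ (u : K) = u → Valued.v ((u : K) - 1) ≤ Valued.v ϖ ^ c → χ₁ u = 1)
    {t : K} (ht : t + σ t = 1)
    {y b x z : K} (hb : b + σ b + y * σ y = 0) (hz : z + σ z + x * σ x = 0)
    {r s r' s' : ℕ} (hy : Valued.v y ≤ Valued.v ϖ ^ r) (hvb : Valued.v b ≤ Valued.v ϖ ^ s)
    (hx : Valued.v x ≤ Valued.v ϖ ^ r') (hvz : Valued.v z ≤ Valued.v ϖ ^ s')
    (h1 : n ≤ r + r') (hT2 : Valued.v t * Valued.v ϖ ^ (s + 2 * r') ≤ Valued.v ϖ ^ n)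
    (hT3 : Valued.v t * Valued.v ϖ ^ (s' + 2 * r) ≤ Valued.v ϖ ^ n) (h4 : c ≤ s + s')
    (h0 : 1 + y * x + b * z ≠ 0) :
    χ₁ (Units.mk0 (1 + y * x + b * z) h0) = 1 := by
  obtain ⟨t₀, ht₀, hmin⟩ := exists_traceMin_of_traceOne σ hσ hvσ ht
  exact chi_mk0_one_add_eq_one_of_traceMin σ hσ hvσ hvϖ χ₁ hc1 hcond hcondF ht₀ hmin hb hz hy hvb hx hvz h1
    (v_mul_pow_le_of_traceMin σ hmin ht hT2) (v_mul_pow_le_of_traceMin σ hmin ht hT3) h4 h0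

end ModelFree

section ConcaveLevelFree

variable {K : Type*} [Field K] [Valued K ℤᵐ⁰] [ValuativeRel K] [(Valued.v : Valuation K ℤᵐ⁰).Compatible]
  (σ : K →+* K) {ϖ : K} {J : Matrix (Fin 3) (Fin 3) K} (hJ : J = (StdForm.antidiagonal 3).over K)
  (hσ : ∀ a, σ (σ a) = a) (hvσ : ∀ a, Valued.v (σ a) = Valued.v a) (hvϖ : Valued.v ϖ = WithZero.exp (-1 : ℤ))
  (e : Fin 3 → Fin 3 → ℕ) (Jg : Subgroup ↥(unitaryGroupOfForm σ J))
  (hJg : ∀ k : ↥(unitaryGroupOfForm σ J), k ∈ Jg ↔ ∀ i j, Valued.v (((k : GL (Fin 3) K) : Matrix (Fin 3) (Fin 3) K) i j) ≤ Valued.v ϖ ^ e i j)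

include hJ hσ hvσ hvϖ hJg in
/-- **★ (O1) §4 WITH THE MINIMALITY LETTER DELETED — `θ(j) := χ₁(j₀₀)` IS MULTIPLICATIVE ON THE TWO-DEPTH GROUP `Jg` FOR ANY TRACE-ONE `t` UNDER THE `|t|`-WEIGHTED
INEQUALITIES** `|t|·|ϖ|^{e 0 2 + 2·e 1 0} ≤ |ϖ|ⁿ`, `|t|·|ϖ|^{e 2 0 + 2·e 0 1} ≤ |ϖ|ⁿ` (★ (O1) `chi_apply_zero_zero_mul_of_concave_min`'s statement with `htmin` removed; a minimal `t₀`
from §2, weights transferred).  At `|t| ≤ 1` this is ★ p862449's regime; at a wild place with `|t| = |ϖ|^{−δ}` it is Roche's `J_χ` carrying `χ̃` iff cond_F reaches the different.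
[cite: Roche1998, §3] [cite: Tits1979, §1.15] [cite: MoyPrasad1996, §3] [cite: BruhatTits1972, (6.4.9)] [cite: Serre1979, Ch. III §3 Prop. 7] -/
theorem chi_apply_zero_zero_mul_of_concave_weighted (h10e : 1 ≤ e 1 0) (h20e : 1 ≤ e 2 0) (χ₁ : Kˣ →* ℂˣ) {n c : ℕ} (hc1 : 1 ≤ c)
    (hcond : ∀ u : Kˣ, Valued.v ((u : K) - 1) ≤ Valued.v ϖ ^ n → χ₁ u = 1)
    (hcondF : ∀ u : Kˣ, σ (u : K) = u → Valued.v ((u : K) - 1) ≤ Valued.v ϖ ^ c → χ₁ u = 1)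
    {t : K} (ht : t + σ t = 1)
    (h1 : n ≤ e 0 1 + e 1 0) (hT2 : Valued.v t * Valued.v ϖ ^ (e 0 2 + 2 * e 1 0) ≤ Valued.v ϖ ^ n)
    (hT3 : Valued.v t * Valued.v ϖ ^ (e 2 0 + 2 * e 0 1) ≤ Valued.v ϖ ^ n) (h4 : c ≤ e 0 2 + e 2 0)
    {j j' : ↥(unitaryGroupOfForm σ J)} (hj : j ∈ Jg) (hj' : j' ∈ Jg)
    (h0 : (((j * j' : ↥(unitaryGroupOfForm σ J)) : GL (Fin 3) K) : Matrix (Fin 3) (Fin 3) K) 0 0 ≠ 0)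
    (h10 : (((j : GL (Fin 3) K) : Matrix (Fin 3) (Fin 3) K) 0 0) ≠ 0) (h20 : (((j' : GL (Fin 3) K) : Matrix (Fin 3) (Fin 3) K) 0 0) ≠ 0) :
    χ₁ (Units.mk0 _ h0) = χ₁ (Units.mk0 _ h10) * χ₁ (Units.mk0 _ h20) := by
  obtain ⟨t₀, ht₀, hmin⟩ := exists_traceMin_of_traceOne σ hσ hvσ ht
  exact chi_apply_zero_zero_mul_of_concave_min σ hJ hσ hvσ hvϖ e Jg hJg h10e h20e χ₁ hc1 hcond hcondF ht₀ hmin h1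
    (v_mul_pow_le_of_traceMin σ hmin ht hT2) (v_mul_pow_le_of_traceMin σ hmin ht hT3) h4 hj hj' h0 h10 h20

end ConcaveLevelFree

/-! ## §3 CM dress: `χ₁((jj′)₀₀) = χ₁(j₀₀)·χ₁(j′₀₀)` on `Je` with a MINIMAL trace-one element of `L_w` (the «θ-CM twin» of ★ (O1)) -/

section CM

variable (L : Type) [Field L] [NumberField L] [IsCMField L] (v : HeightOneSpectrum (𝓞 ↥(maximalRealSubfield L)))
  (w : PlacesOver L v) (hw : IsCMField.complexConj L • w.1 = w.1)
  (eA : Gqs L v ≃ₜ* ↥(unitaryGroupOfForm (galAdicCompletionMap (L := L) (IsCMField.complexConj L) hw) ((StdForm.antidiagonal 3).over (w.1.adicCompletion L))))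
  (heA : ∀ g : Gqs L v,
    ((eA g : ↥(unitaryGroupOfForm (galAdicCompletionMap (L := L) (IsCMField.complexConj L) hw) ((StdForm.antidiagonal 3).over (w.1.adicCompletion L)))) :
        GL (Fin 3) (w.1.adicCompletion L)) =
      ((localNonsplitEquiv (IsCMField.complexConj L) (qsForm L) (IsCMField.complexConj_ne_one L) w hw g :
        ↥(unitaryGroupOfForm (galAdicCompletionMap (L := L) (IsCMField.complexConj L) hw) (placeForm (qsForm L) w.1))) : GL (Fin 3) (w.1.adicCompletion L)))
  {ϖ : w.1.adicCompletion L} (hϖ : Valued.v ϖ = WithZero.exp (-1 : ℤ))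
  (e : Fin 3 → Fin 3 → ℕ)
  (Jg : Subgroup ↥(unitaryGroupOfForm (galAdicCompletionMap (L := L) (IsCMField.complexConj L) hw) ((StdForm.antidiagonal 3).over (w.1.adicCompletion L))))
  (hJg : ∀ k : ↥(unitaryGroupOfForm (galAdicCompletionMap (L := L) (IsCMField.complexConj L) hw) ((StdForm.antidiagonal 3).over (w.1.adicCompletion L))),
    k ∈ Jg ↔ ∀ i j, Valued.v (((k : GL (Fin 3) (w.1.adicCompletion L)) : Matrix (Fin 3) (Fin 3) (w.1.adicCompletion L)) i j) ≤ Valued.v ϖ ^ e i j)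
  (Je : Subgroup (Gqs L v)) (hJe : Je = Jg.comap eA.toMulEquiv.toMonoidHom)

open Classical in
include heA hϖ hJg hJe in
set_option maxHeartbeats 400000 in
-- the statement's `IsUnit` binders on `L ⊗ L⁺_v`-valued matrix entries time out at `whnf` under the default 200000 (measured; class of ★ `K2E3ConcaveLevelIwahoriCharacterCM`)
/-- **`χ₁((jj′)₀₀) = χ₁(j₀₀)·χ₁(j′₀₀)` for `j, j′ ∈ Je` WITH A MINIMAL TRACE-ONE ELEMENT** — the twin of ★ p862709 `chi_unit_apply_zero_zero_mul_concave` with `|t| ≤ 1` replaced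
by MINIMALITY `htmin` and `n ≤ 2·e 0 1 + e 2 0`, `n ≤ e 0 2 + 2·e 1 0` by the `|t|`-WEIGHTED `|t|·|ϖ|^{e 0 2 + 2·e 1 0} ≤ |ϖ|ⁿ`, `|t|·|ϖ|^{e 2 0 + 2·e 0 1} ≤ |ϖ|ⁿ` (no `c ≤ n`);
`χ₁ : (L ⊗ L⁺_v)ˣ → ℂˣ` with `hcond` (E-conductor `≤ n`), `hcondF` (F-conductor `≤ c` on the `(c ⊗ 1)`-fixed units).  Proof = ★ p862709's, reading `U = (jj′)₀₀ (j₀₀ j′₀₀)⁻¹` at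
the one place `w` as `(1 + βζ) + E` with `|βζ|_w ≤ |ϖ|^c`, `|E|_w ≤ |ϖ|ⁿ` (§1). [cite: Roche1998, §3] [cite: Tits1979, §1.15] [cite: MoyPrasad1996, §3] [cite: PlatonovRapinchuk1994, §5.1] -/
theorem chi_unit_apply_zero_zero_mul_concave_min (h10e : 1 ≤ e 1 0) (h20e : 1 ≤ e 2 0) (χ₁ : (LocalRing L v)ˣ →* ℂˣ) {n c : ℕ} (hc1 : 1 ≤ c)
    (hcond : ∀ u : (LocalRing L v)ˣ, (∀ w' : PlacesOver L v, Valued.v (((u : LocalRing L v) w') - 1) ≤ Valued.v ϖ ^ n) → χ₁ u = 1)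
    (hcondF : ∀ u : (LocalRing L v)ˣ, Units.map (conjLocal L (IsCMField.complexConj L) v : LocalRing L v →* LocalRing L v) u = u →
      (∀ w' : PlacesOver L v, Valued.v (((u : LocalRing L v) w') - 1) ≤ Valued.v ϖ ^ c) → χ₁ u = 1)
    {t : w.1.adicCompletion L} (ht : t + galAdicCompletionMap (L := L) (IsCMField.complexConj L) hw t = 1)
    (htmin : ∀ a : w.1.adicCompletion L, a + galAdicCompletionMap (L := L) (IsCMField.complexConj L) hw a = 1 → Valued.v t ≤ Valued.v a)
    (h1 : n ≤ e 0 1 + e 1 0) (hT2 : Valued.v t * Valued.v ϖ ^ (e 0 2 + 2 * e 1 0) ≤ Valued.v ϖ ^ n)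
    (hT3 : Valued.v t * Valued.v ϖ ^ (e 2 0 + 2 * e 0 1) ≤ Valued.v ϖ ^ n) (h4 : c ≤ e 0 2 + e 2 0)
    {j j' : Gqs L v} (hj : j ∈ Je) (hj' : j' ∈ Je)
    (h0 : IsUnit ((((j * j').val : GL (Fin 3) (LocalRing L v)) : Matrix (Fin 3) (Fin 3) (LocalRing L v)) 0 0))
    (hu1 : IsUnit (((j.val : GL (Fin 3) (LocalRing L v)) : Matrix (Fin 3) (Fin 3) (LocalRing L v)) 0 0))
    (hu2 : IsUnit (((j'.val : GL (Fin 3) (LocalRing L v)) : Matrix (Fin 3) (Fin 3) (LocalRing L v)) 0 0)) :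
    χ₁ h0.unit = χ₁ hu1.unit * χ₁ hu2.unit := by
  have hσσ : ∀ x, (galAdicCompletionMap (L := L) (IsCMField.complexConj L) hw) ((galAdicCompletionMap (L := L) (IsCMField.complexConj L) hw) x) = x :=
    galAdicCompletionMap_galAdicCompletionMap_of_smul_eq (IsCMField.complexConj L) w (IsCMField.complexConj_ne_one L) hw
  have hvσ : ∀ x, Valued.v (galAdicCompletionMap (L := L) (IsCMField.complexConj L) hw x) = Valued.v x :=
    fun x => valued_galAdicCompletionMap (L := L) (IsCMField.complexConj L) hw x
  have hvϖ1 : Valued.v ϖ < 1 := by rw [hϖ, ← WithZero.exp_zero, WithZero.exp_lt_exp]; norm_num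
  have hvϖc : Valued.v ϖ ^ c < 1 := pow_lt_one' hvϖ1 (Nat.one_le_iff_ne_zero.1 hc1)
  have hjg := K2E3ConcaveLevelIwahoriCharacterCM.map_mem_of_mem L v w hw eA Jg Je hJe hj
  have hj'g := K2E3ConcaveLevelIwahoriCharacterCM.map_mem_of_mem L v w hw eA Jg Je hJe hj'
  set A : w.1.adicCompletion L := ((j.val : GL (Fin 3) (LocalRing L v)) : Matrix (Fin 3) (Fin 3) (LocalRing L v)) 0 0 w with hA
  set a' : w.1.adicCompletion L := ((j'.val : GL (Fin 3) (LocalRing L v)) : Matrix (Fin 3) (Fin 3) (LocalRing L v)) 0 0 w with ha'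
  have hAe : (((eA j : ↥(unitaryGroupOfForm (galAdicCompletionMap (L := L) (IsCMField.complexConj L) hw) ((StdForm.antidiagonal 3).over (w.1.adicCompletion L)))) :
      GL (Fin 3) (w.1.adicCompletion L)) : Matrix (Fin 3) (Fin 3) (w.1.adicCompletion L)) 0 0 = A := coe_eA_apply L v w hw eA heA j 0 0
  have ha'e : (((eA j' : ↥(unitaryGroupOfForm (galAdicCompletionMap (L := L) (IsCMField.complexConj L) hw) ((StdForm.antidiagonal 3).over (w.1.adicCompletion L)))) :
      GL (Fin 3) (w.1.adicCompletion L)) : Matrix (Fin 3) (Fin 3) (w.1.adicCompletion L)) 0 0 = a' := coe_eA_apply L v w hw eA heA j' 0 0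
  have hvA : Valued.v A = 1 := by
    rw [← hAe]
    exact K2E3IwahoriTwoDepthFactorisation.v_apply_zero_zero_eq_one_of_mem _ rfl hvσ hϖ e Jg hJg h10e h20e hjg
  have hva' : Valued.v a' = 1 := by
    rw [← ha'e]
    exact K2E3IwahoriTwoDepthFactorisation.v_apply_zero_zero_eq_one_of_mem _ rfl hvσ hϖ e Jg hJg h10e h20e hj'g
  have hA0 : A ≠ 0 := fun h => by rw [h, map_zero] at hvA; exact zero_ne_one hvA
  have ha'0 : a' ≠ 0 := fun h => by rw [h, map_zero] at hva'; exact zero_ne_one hva'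
  have hA0e : (((eA j : ↥(unitaryGroupOfForm (galAdicCompletionMap (L := L) (IsCMField.complexConj L) hw) ((StdForm.antidiagonal 3).over (w.1.adicCompletion L)))) :
      GL (Fin 3) (w.1.adicCompletion L)) : Matrix (Fin 3) (Fin 3) (w.1.adicCompletion L)) 0 0 ≠ 0 := by rw [hAe]; exact hA0
  have ha'0e : (((eA j' : ↥(unitaryGroupOfForm (galAdicCompletionMap (L := L) (IsCMField.complexConj L) hw) ((StdForm.antidiagonal 3).over (w.1.adicCompletion L)))) :
      GL (Fin 3) (w.1.adicCompletion L)) : Matrix (Fin 3) (Fin 3) (w.1.adicCompletion L)) 0 0 ≠ 0 := by rw [ha'e]; exact ha'0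
  set y : w.1.adicCompletion L := (((eA j : ↥(unitaryGroupOfForm (galAdicCompletionMap (L := L) (IsCMField.complexConj L) hw) ((StdForm.antidiagonal 3).over
      (w.1.adicCompletion L)))) : GL (Fin 3) (w.1.adicCompletion L)) : Matrix (Fin 3) (Fin 3) (w.1.adicCompletion L)) 0 1 / A with hy
  set b : w.1.adicCompletion L := (((eA j : ↥(unitaryGroupOfForm (galAdicCompletionMap (L := L) (IsCMField.complexConj L) hw) ((StdForm.antidiagonal 3).over
      (w.1.adicCompletion L)))) : GL (Fin 3) (w.1.adicCompletion L)) : Matrix (Fin 3) (Fin 3) (w.1.adicCompletion L)) 0 2 / A with hb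
  set x : w.1.adicCompletion L := (((eA j' : ↥(unitaryGroupOfForm (galAdicCompletionMap (L := L) (IsCMField.complexConj L) hw) ((StdForm.antidiagonal 3).over
      (w.1.adicCompletion L)))) : GL (Fin 3) (w.1.adicCompletion L)) : Matrix (Fin 3) (Fin 3) (w.1.adicCompletion L)) 1 0 / a' with hx
  set z : w.1.adicCompletion L := (((eA j' : ↥(unitaryGroupOfForm (galAdicCompletionMap (L := L) (IsCMField.complexConj L) hw) ((StdForm.antidiagonal 3).over
      (w.1.adicCompletion L)))) : GL (Fin 3) (w.1.adicCompletion L)) : Matrix (Fin 3) (Fin 3) (w.1.adicCompletion L)) 2 0 / a' with hz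
  have hP : (((j * j').val : GL (Fin 3) (LocalRing L v)) : Matrix (Fin 3) (Fin 3) (LocalRing L v)) 0 0 w = A * a' * (1 + y * x + b * z) := by
    rw [← coe_eA_apply L v w hw eA heA (j * j') 0 0, map_mul, hy, hb, hx, hz, ← hAe, ← ha'e]
    exact K2E3ConcaveLevelIwahoriCharacter.mul_apply_zero_zero_eq _ (eA j) (eA j') hA0e ha'0e
  have hrow : b + galAdicCompletionMap (L := L) (IsCMField.complexConj L) hw b + y * galAdicCompletionMap (L := L) (IsCMField.complexConj L) hw y = 0 := by
    rw [hb, hy, ← hAe]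
    exact K2E3ConcaveLevelIwahoriCharacter.row_zero_rel _ rfl hσσ (eA j) hA0e
  have hcol : z + galAdicCompletionMap (L := L) (IsCMField.complexConj L) hw z + x * galAdicCompletionMap (L := L) (IsCMField.complexConj L) hw x = 0 := by
    rw [hz, hx, ← ha'e]
    exact K2E3ConcaveLevelIwahoriCharacter.col_zero_rel _ rfl (eA j') ha'0e
  have hvy : Valued.v y ≤ Valued.v ϖ ^ e 0 1 := by rw [hy, map_div₀, hvA, div_one]; exact ((hJg _).1 hjg) 0 1
  have hvb : Valued.v b ≤ Valued.v ϖ ^ e 0 2 := by rw [hb, map_div₀, hvA, div_one]; exact ((hJg _).1 hjg) 0 2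
  have hvx : Valued.v x ≤ Valued.v ϖ ^ e 1 0 := by rw [hx, map_div₀, hva', div_one]; exact ((hJg _).1 hj'g) 1 0
  have hvz : Valued.v z ≤ Valued.v ϖ ^ e 2 0 := by rw [hz, map_div₀, hva', div_one]; exact ((hJg _).1 hj'g) 2 0
  have hvβζ' : Valued.v ((b + t * (y * galAdicCompletionMap (L := L) (IsCMField.complexConj L) hw y)) *
      (z + t * (x * galAdicCompletionMap (L := L) (IsCMField.complexConj L) hw x))) ≤ Valued.v ϖ ^ c :=
    v_beta_mul_zeta_le_of_traceMin _ hσσ hϖ htmin hrow hcol hvb hvz h4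
  have hE := v_traceMin_correction_le _ hσσ hvσ hϖ htmin hrow hcol hvy hvb hvx hvz h1 hT2 hT3
  set β : w.1.adicCompletion L := b + t * (y * galAdicCompletionMap (L := L) (IsCMField.complexConj L) hw y) with hβ
  set ζ : w.1.adicCompletion L := z + t * (x * galAdicCompletionMap (L := L) (IsCMField.complexConj L) hw x) with hζ
  have hσβ : galAdicCompletionMap (L := L) (IsCMField.complexConj L) hw β = -β := K2E3ConcaveLevelIwahoriCharacter.sigma_add_mul_eq_neg _ hσσ ht hrow
  have hσζ : galAdicCompletionMap (L := L) (IsCMField.complexConj L) hw ζ = -ζ := K2E3ConcaveLevelIwahoriCharacter.sigma_add_mul_eq_neg _ hσσ ht hcol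
  have hvβζ : Valued.v (β * ζ) ≤ Valued.v ϖ ^ c := hvβζ'
  have hvF : Valued.v (1 + β * ζ) = 1 := Valued.v.map_one_add_of_lt (hvβζ.trans_lt hvϖc)
  have hF0 : 1 + β * ζ ≠ 0 := fun h => by rw [h, map_zero] at hvF; exact zero_ne_one hvF
  have hσF : galAdicCompletionMap (L := L) (IsCMField.complexConj L) hw (1 + β * ζ) = 1 + β * ζ := by
    rw [map_add, map_one, map_mul, hσβ, hσζ, neg_mul_neg]
  have hdecomp := K2E3ConcaveLevelIwahoriCharacter.one_add_mul_add_mul_eq (galAdicCompletionMap (L := L) (IsCMField.complexConj L) hw) t y b x z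
  -- `U_F` (the one-place unit of `1 + βζ`) is `(c ⊗ 1)`-fixed and `≡ 1 (mod 𝔭^c)`; `U · U_F⁻¹ ≡ 1 (mod 𝔭ⁿ)`; both killed by `χ₁`
  have hUF := K2E3ConcaveLevelIwahoriCharacterCM.isUnit_update_of_ne_zero L v w hw hF0
  have hχF : χ₁ hUF.unit = 1 := by
    refine hcondF _ (K2E3ConcaveLevelIwahoriCharacterCM.conjLocal_update_fixed L v w hw hF0 hσF) fun w' => ?_
    obtain rfl := PlacesOver.eq_of_smul_eq (IsCMField.complexConj L) (IsCMField.complexConj_ne_one L) w hw w'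
    rw [IsUnit.unit_spec, Function.update_self, add_sub_cancel_left]
    exact hvβζ
  have hχE : χ₁ (h0.unit * (hu1.unit * hu2.unit)⁻¹ * hUF.unit⁻¹) = 1 := by
    refine hcond _ fun w' => ?_
    obtain rfl := PlacesOver.eq_of_smul_eq (IsCMField.complexConj L) (IsCMField.complexConj_ne_one L) w hw w'
    rw [Units.val_mul, Units.val_inv_eq_inv_val, Units.val_mul, Units.val_inv_eq_inv_val, Units.val_mul, IsUnit.unit_spec, IsUnit.unit_spec, IsUnit.unit_spec,
      IsUnit.unit_spec, Pi.mul_apply, Pi.inv_apply, Pi.mul_apply, Pi.inv_apply, Pi.mul_apply, Function.update_self, hP, ← hA, ← ha',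
      show A * a' * (1 + y * x + b * z) * (A * a')⁻¹ * (1 + β * ζ)⁻¹ - 1 = ((1 + y * x + b * z) - (1 + β * ζ)) * (1 + β * ζ)⁻¹ by field_simp,
      map_mul, map_inv₀, hvF, inv_one, mul_one, hdecomp, hβ, hζ, add_sub_cancel_left]
    exact hE
  rw [map_mul, map_mul, map_inv, map_inv, hχF, inv_one, mul_one, mul_inv_eq_one] at hχE
  rw [hχE, map_mul]

open Classical in
include heA hϖ hJg hJe in
/-- **`θ(jj′) = θ(j)·θ(j′)` ON `Je` WITH A MINIMAL TRACE-ONE ELEMENT** for `θ(g) := if h : IsUnit g₀₀ then χ₁(h.unit) else 0` — the twin of ★ p862709 `theta_mul_concave` with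
`hvt ↦ htmin` and the weighted concavity inequalities (the letter `hθmul` of ★ V2b at `B = Je`, minimal-`t` form). [cite: Roche1998, §3] [cite: Tits1979, §1.15]
[cite: MoyPrasad1996, §3] [cite: BruhatTits1972, (6.4.9)] -/
theorem theta_mul_concave_min (h10e : 1 ≤ e 1 0) (h20e : 1 ≤ e 2 0) (χ₁ : (LocalRing L v)ˣ →* ℂˣ) {n c : ℕ} (hc1 : 1 ≤ c)
    (hcond : ∀ u : (LocalRing L v)ˣ, (∀ w' : PlacesOver L v, Valued.v (((u : LocalRing L v) w') - 1) ≤ Valued.v ϖ ^ n) → χ₁ u = 1)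
    (hcondF : ∀ u : (LocalRing L v)ˣ, Units.map (conjLocal L (IsCMField.complexConj L) v : LocalRing L v →* LocalRing L v) u = u →
      (∀ w' : PlacesOver L v, Valued.v (((u : LocalRing L v) w') - 1) ≤ Valued.v ϖ ^ c) → χ₁ u = 1)
    {t : w.1.adicCompletion L} (ht : t + galAdicCompletionMap (L := L) (IsCMField.complexConj L) hw t = 1)
    (htmin : ∀ a : w.1.adicCompletion L, a + galAdicCompletionMap (L := L) (IsCMField.complexConj L) hw a = 1 → Valued.v t ≤ Valued.v a)
    (h1 : n ≤ e 0 1 + e 1 0) (hT2 : Valued.v t * Valued.v ϖ ^ (e 0 2 + 2 * e 1 0) ≤ Valued.v ϖ ^ n)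
    (hT3 : Valued.v t * Valued.v ϖ ^ (e 2 0 + 2 * e 0 1) ≤ Valued.v ϖ ^ n) (h4 : c ≤ e 0 2 + e 2 0)
    {j j' : Gqs L v} (hj : j ∈ Je) (hj' : j' ∈ Je) :
    (if h : IsUnit ((((j * j').val : GL (Fin 3) (LocalRing L v)) : Matrix (Fin 3) (Fin 3) (LocalRing L v)) 0 0) then ((χ₁ h.unit : ℂˣ) : ℂ) else 0) =
      (if h : IsUnit (((j.val : GL (Fin 3) (LocalRing L v)) : Matrix (Fin 3) (Fin 3) (LocalRing L v)) 0 0) then ((χ₁ h.unit : ℂˣ) : ℂ) else 0) *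
        (if h : IsUnit (((j'.val : GL (Fin 3) (LocalRing L v)) : Matrix (Fin 3) (Fin 3) (LocalRing L v)) 0 0) then ((χ₁ h.unit : ℂˣ) : ℂ) else 0) := by
  have h0 := K2E3ConcaveLevelIwahoriCharacterCM.isUnit_apply_zero_zero_of_mem L v w hw eA heA hϖ e Jg hJg Je hJe h10e h20e (Subgroup.mul_mem _ hj hj')
  have hu1 := K2E3ConcaveLevelIwahoriCharacterCM.isUnit_apply_zero_zero_of_mem L v w hw eA heA hϖ e Jg hJg Je hJe h10e h20e hj
  have hu2 := K2E3ConcaveLevelIwahoriCharacterCM.isUnit_apply_zero_zero_of_mem L v w hw eA heA hϖ e Jg hJg Je hJe h10e h20e hj'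
  rw [dif_pos h0, dif_pos hu1, dif_pos hu2, ← Units.val_mul,
    chi_unit_apply_zero_zero_mul_concave_min L v w hw eA heA hϖ e Jg hJg Je hJe h10e h20e χ₁ hc1 hcond hcondF ht htmin h1 hT2 hT3 h4 hj hj' h0 hu1 hu2]

/-! ## §4 CM dress, OF RECORD: the minimality letter discharged by ★ (W-0) `exists_traceOne_min_adic` — ANY trace-one `t ∈ L_w` under the `|t|`-weighted inequalities -/

open Classical in
include heA hϖ hJg hJe in
set_option maxHeartbeats 400000 in
-- as §3: the `IsUnit` binders on `L ⊗ L⁺_v`-valued matrix entries (class of ★ `K2E3ConcaveLevelIwahoriCharacterCM`)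
/-- **`χ₁((jj′)₀₀) = χ₁(j₀₀)·χ₁(j′₀₀)` ON `Je` FOR ANY TRACE-ONE `t` UNDER THE `|t|`-WEIGHTED INEQUALITIES — OF RECORD**: §3's statement with NEITHER `|t| ≤ 1` NOR `htmin`.
Proof: §3 at a MINIMAL trace-one `t₀` (`obtain ⟨t₀, ht₀, hmin⟩ := exists_traceOne_min_adic L v w hw`, ★ (W-0)), weights transferred by `|t₀| ≤ |t|`.  At `|t| ≤ 1` this is ★
`chi_unit_apply_zero_zero_mul_concave` without `c ≤ n`; at a wild place (`|t| = |ϖ|^{−δ}`) the regime «cond_F reaches the different». [cite: Roche1998, §3] [cite: Tits1979, §1.15]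
[cite: Serre1979, Ch. III §3 Prop. 7] [cite: PlatonovRapinchuk1994, §5.1] -/
theorem chi_unit_apply_zero_zero_mul_concave_ofRecord (h10e : 1 ≤ e 1 0) (h20e : 1 ≤ e 2 0) (χ₁ : (LocalRing L v)ˣ →* ℂˣ) {n c : ℕ} (hc1 : 1 ≤ c)
    (hcond : ∀ u : (LocalRing L v)ˣ, (∀ w' : PlacesOver L v, Valued.v (((u : LocalRing L v) w') - 1) ≤ Valued.v ϖ ^ n) → χ₁ u = 1)
    (hcondF : ∀ u : (LocalRing L v)ˣ, Units.map (conjLocal L (IsCMField.complexConj L) v : LocalRing L v →* LocalRing L v) u = u →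
      (∀ w' : PlacesOver L v, Valued.v (((u : LocalRing L v) w') - 1) ≤ Valued.v ϖ ^ c) → χ₁ u = 1)
    {t : w.1.adicCompletion L} (ht : t + galAdicCompletionMap (L := L) (IsCMField.complexConj L) hw t = 1)
    (h1 : n ≤ e 0 1 + e 1 0) (hT2 : Valued.v t * Valued.v ϖ ^ (e 0 2 + 2 * e 1 0) ≤ Valued.v ϖ ^ n)
    (hT3 : Valued.v t * Valued.v ϖ ^ (e 2 0 + 2 * e 0 1) ≤ Valued.v ϖ ^ n) (h4 : c ≤ e 0 2 + e 2 0)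
    {j j' : Gqs L v} (hj : j ∈ Je) (hj' : j' ∈ Je)
    (h0 : IsUnit ((((j * j').val : GL (Fin 3) (LocalRing L v)) : Matrix (Fin 3) (Fin 3) (LocalRing L v)) 0 0))
    (hu1 : IsUnit (((j.val : GL (Fin 3) (LocalRing L v)) : Matrix (Fin 3) (Fin 3) (LocalRing L v)) 0 0))
    (hu2 : IsUnit (((j'.val : GL (Fin 3) (LocalRing L v)) : Matrix (Fin 3) (Fin 3) (LocalRing L v)) 0 0)) :
    χ₁ h0.unit = χ₁ hu1.unit * χ₁ hu2.unit := by
  obtain ⟨t₀, ht₀, hmin⟩ := exists_traceOne_min_adic L v w hw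
  exact chi_unit_apply_zero_zero_mul_concave_min L v w hw eA heA hϖ e Jg hJg Je hJe h10e h20e χ₁ hc1 hcond hcondF ht₀ hmin h1
    (v_mul_pow_le_of_traceMin _ hmin ht hT2) (v_mul_pow_le_of_traceMin _ hmin ht hT3) h4 hj hj' h0 hu1 hu2

open Classical in
include heA hϖ hJg hJe in
/-- **`θ(jj′) = θ(j)·θ(j′)` ON `Je` FOR ANY TRACE-ONE `t` UNDER THE `|t|`-WEIGHTED INEQUALITIES — the letter `hθmul` of ★ V2b at `B = Je`, OF RECORD** (★ p862709
`theta_mul_concave`'s statement with `hvt`, `hcn` removed and `h2`, `h3` weighted by `|t|`; minimality discharged by ★ (W-0) `exists_traceOne_min_adic`).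
[cite: Roche1998, §3] [cite: Tits1979, §1.15] [cite: Serre1979, Ch. III §3 Prop. 7] [cite: MoyPrasad1996, §3] -/
theorem theta_mul_concave_ofRecord (h10e : 1 ≤ e 1 0) (h20e : 1 ≤ e 2 0) (χ₁ : (LocalRing L v)ˣ →* ℂˣ) {n c : ℕ} (hc1 : 1 ≤ c)
    (hcond : ∀ u : (LocalRing L v)ˣ, (∀ w' : PlacesOver L v, Valued.v (((u : LocalRing L v) w') - 1) ≤ Valued.v ϖ ^ n) → χ₁ u = 1)
    (hcondF : ∀ u : (LocalRing L v)ˣ, Units.map (conjLocal L (IsCMField.complexConj L) v : LocalRing L v →* LocalRing L v) u = u →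
      (∀ w' : PlacesOver L v, Valued.v (((u : LocalRing L v) w') - 1) ≤ Valued.v ϖ ^ c) → χ₁ u = 1)
    {t : w.1.adicCompletion L} (ht : t + galAdicCompletionMap (L := L) (IsCMField.complexConj L) hw t = 1)
    (h1 : n ≤ e 0 1 + e 1 0) (hT2 : Valued.v t * Valued.v ϖ ^ (e 0 2 + 2 * e 1 0) ≤ Valued.v ϖ ^ n)
    (hT3 : Valued.v t * Valued.v ϖ ^ (e 2 0 + 2 * e 0 1) ≤ Valued.v ϖ ^ n) (h4 : c ≤ e 0 2 + e 2 0)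
    {j j' : Gqs L v} (hj : j ∈ Je) (hj' : j' ∈ Je) :
    (if h : IsUnit ((((j * j').val : GL (Fin 3) (LocalRing L v)) : Matrix (Fin 3) (Fin 3) (LocalRing L v)) 0 0) then ((χ₁ h.unit : ℂˣ) : ℂ) else 0) =
      (if h : IsUnit (((j.val : GL (Fin 3) (LocalRing L v)) : Matrix (Fin 3) (Fin 3) (LocalRing L v)) 0 0) then ((χ₁ h.unit : ℂˣ) : ℂ) else 0) *
        (if h : IsUnit (((j'.val : GL (Fin 3) (LocalRing L v)) : Matrix (Fin 3) (Fin 3) (LocalRing L v)) 0 0) then ((χ₁ h.unit : ℂˣ) : ℂ) else 0) := by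
  obtain ⟨t₀, ht₀, hmin⟩ := exists_traceOne_min_adic L v w hw
  exact theta_mul_concave_min L v w hw eA heA hϖ e Jg hJg Je hJe h10e h20e χ₁ hc1 hcond hcondF ht₀ hmin h1
    (v_mul_pow_le_of_traceMin _ hmin ht hT2) (v_mul_pow_le_of_traceMin _ hmin ht hT3) h4 hj hj'

end CM

end Summit.HodgeConjecture.HodgeConjecture.R90.S1.WildConcaveLevelMinOfRecord

end
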